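import Summits.FinalStateConjecture.FinalStateConjecture.Theorems.SwallowTheDatumBurialIntoShieldedBackgroundFlat
import Summits.FinalStateConjecture.FinalStateConjecture.Theorems.SwallowTheDatumParametricKerrBurialCollarDilation
import Literature.Geometry.Lorentzian.TrivialDataAdmissible
import Literature.Geometry.Manifold.BilinFamilyPullback
import Literature.Geometry.Manifold.OpenSubmanifoldMFDeriv

/-!
# Route `SwallowTheDatum` · item `BurialIntoShieldedBackground` (stmt-FinalStateConjecture-14721) —
# the item ON THE FLAT STRATUM, unconditionally; transport of burials; `(Minkowski.slice, trivialData)`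

Companion of `SwallowTheDatumBurialIntoShieldedBackground.lean` (covariances, frames) and `…Flat.lean` (the relative
burial of the flat datum on `ℝ³`, proved there modulo the hypothesis `hdil` = the registered dilation stub
`isKerrShieldedAway_dilate` of the crux stmt-FinalStateConjecture-10052).  That stub has meanwhile LANDED
(`Theorems/SwallowTheDatumParametricKerrBurialCollarDilation.lean`, `CollarDilation.isKerrShieldedAway_dilate`, line
`receding-annulus-universal-collar`), so everything here is UNCONDITIONAL (sorry-free, definition-free, no hypothesis
beyond the item's own):

* §1 `isKerrShieldedAway_dilate_components` — the stub in the pointwise form used as `hdil` (a datum with the dilated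
  components IS the dilate, `InitialDataSet.ext'`), discharged by the landed theorem; `flatBurial`, `selfBurial` —
  the theorems of `…Flat.lean` with `hdil` discharged;
* §2 `burial_comap` — BURIALS TRANSPORT ALONG DIFFEOMORPHISMS `Y ≅ ℝ³`: through `Θ^* d` passes `c ↦ Θ^*(F c)`
  (parametric pullback of the coordinate readings, `contMDiffAt_pullbackBilin_family`; `dΘ_u` onto ⇒ injective;
  diffeomorphism invariance/covariance of the admissible class and of the shield);
* §3 `trivialData_burial` — **`KerrShieldedDataExist` implies the conclusion of `ParametricKerrBurial` at the tree's
  instance `(X, d) = (Minkowski.slice, trivialData)`** (`ModelData.lean`): identify the slice with `ℝ³` along the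
  inclusion (`dι = id`, `OpenSubmanifold.mfderiv_subtype_val`), bury `(ι⁻¹)^* trivialData` by `flatBurial`, transport
  back.  This is the instance of the disprover's `parametricKerrBurial_false_without_ne_zero` (the crux is false
  WITHOUT the guard `c ≠ 0` at `trivialData`): WITH the guard the burial exists as soon as one shielded background
  does — the item `BurialIntoShieldedBackground = (KerrShieldedDataExist → ParametricKerrBurial)` HOLDS ON THE FLAT
  STRATUM; `constFlat_burial` — the same for every admissible constant-coefficient flat datum `(Q, 0)` on `ℝ³`;
  `burial_comap_constFlat` — and at every `(X, Θ^*(Q, 0))`, `Θ : X ≅ ℝ³` (the whole flat stratum).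

What remains of the item is exactly the glued stratum (general `d`): the crux's gluing engine.

References: route file `Theses/SwallowTheDatum.lean` (items 14721, 10052, 10055); O'Neill 1983, Ch. 3, Def. 3.9;
Lee 2013, Example 1.26; Bartnik–Isenberg 2004, §2; Christodoulou 1999, p. A24.
-/

-- `Summit.<Summit>.<Problem>` is the tree's mandated summit-side namespace (CONVENTIONS §2); for this
-- single-conjunct summit the two coincide, so the duplicate is deliberate.
set_option linter.dupNamespace false

noncomputable section

namespace Summit.FinalStateConjecture.FinalStateConjecture.Theorems.SwallowTheDatum.BurialIntoShieldedBackground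

open scoped Manifold ContDiff Topology InnerProductSpace
open Bundle Set Function Literature.Geometry.Lorentzian
open Summit.FinalStateConjecture.FinalStateConjecture.Theses.SwallowTheDatum
  (ParametricKerrBurial KerrShieldedDataExist BurialIntoShieldedBackground)
open Summit.FinalStateConjecture.FinalStateConjecture.Theorems.SwallowTheDatum.ParametricKerrBurial
  (IsKerrShielded IsKerrShieldedAway)

/-! ## §1 The dilation stub, discharged; the flat burial and the self-burial unconditionally -/

section Discharge

variable [Kerr.Facts]

/-- **The registered dilation stub of the crux in the pointwise form `hdil` of `…Flat.lean`, DISCHARGED**: a datum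
`D` with components `h_D(x) = h_C(x/l)`, `k_D(x) = l⁻¹ k_C(x/l)` is the dilate `C.dilate l` (`InitialDataSet.ext'`,
`dilate_h_inner`, `dilate_k`), so the landed `CollarDilation.isKerrShieldedAway_dilate` applies. [folklore] -/
theorem isKerrShieldedAway_dilate_components :
    ∀ (l ρ : ℝ) (C D : InitialDataSet (𝓡 3) E3), 0 < l →
      (∀ x v w : E3, D.h.inner x v w = C.h.inner (l⁻¹ • x) v w) →
      (∀ x v w : E3, D.k x v w = l⁻¹ * C.k (l⁻¹ • x) v w) →
      IsKerrShieldedAway ρ C → IsKerrShieldedAway (l * ρ) D := by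
  intro l ρ C D hl hh hk h
  have hD : D = C.dilate l hl :=
    InitialDataSet.ext' (fun x v w ↦ by rw [hh, C.dilate_h_inner l hl]) (fun x v w ↦ by rw [hk, C.dilate_k l hl])
  rw [hD]
  exact ParametricKerrBurial.CollarDilation.isKerrShieldedAway_dilate C hl h

/-- **THE RELATIVE BURIAL OF THE FLAT DATUM, unconditionally** (`flat_burial` of `…Flat.lean` with `hdil` discharged):
for `B` admissible and Kerr-shielded and `d = (δ, 0)` admissible on `ℝ³`, through `d` passes a smooth injective
admissible one-parameter family whose members off `c = 0` are Kerr-shielded. [folklore] -/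
theorem flatBurial {B : InitialDataSet (𝓡 3) E3} (hB : B ∈ admissibleVacuumData E3) (hBs : IsKerrShielded E3 B)
    {d : InitialDataSet (𝓡 3) E3} (hd : d ∈ admissibleVacuumData E3)
    (hdh : ∀ y v w : E3, d.h.inner y v w = ⟪v, w⟫_ℝ) (hdk : ∀ y v w : E3, d.k y v w = 0) :
    ∃ F : EuclideanSpace ℝ (Fin 1) → InitialDataSet (𝓡 3) E3,
      InitialDataSet.IsSmoothDataFamily 1 F ∧ F 0 = d ∧ Injective F ∧
        (∀ c, F c ∈ admissibleVacuumData E3) ∧ ∀ c ≠ 0, IsKerrShielded E3 (F c) :=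
  flat_burial isKerrShieldedAway_dilate_components hB hBs hd hdh hdk

/-- **Every Kerr-shielded admissible datum on `ℝ³` buries itself, unconditionally** (`self_burial` with `hdil`
discharged): the exponential homothety thread through `B` is smooth, injective, admissible, and ALL its members are
Kerr-shielded. [folklore] -/
theorem selfBurial {B : InitialDataSet (𝓡 3) E3} (hB : B ∈ admissibleVacuumData E3) (hBs : IsKerrShielded E3 B) :
    ∃ F : EuclideanSpace ℝ (Fin 1) → InitialDataSet (𝓡 3) E3,
      InitialDataSet.IsSmoothDataFamily 1 F ∧ F 0 = B ∧ Injective F ∧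
        (∀ c, F c ∈ admissibleVacuumData E3) ∧ ∀ c, IsKerrShielded E3 (F c) :=
  self_burial isKerrShieldedAway_dilate_components hB hBs

end Discharge

/-! ## §2 Transport of burials along diffeomorphisms onto `ℝ³` -/

section Transport

variable [Kerr.Facts] {Y : Type} [TopologicalSpace Y] [ChartedSpace E3 Y] [IsManifold (𝓡 3) ∞ Y]

/-- **Burials transport along diffeomorphisms onto `ℝ³`.**  If through `d` on `ℝ³` passes a burial family `F`
(smooth, injective, admissible, shielded off `c = 0`), then through `Θ^* d` on `Y ≅ ℝ³` passes the burial family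
`c ↦ Θ^*(F c)`: jointly smooth by the parametric pullback of the coordinate readings of `F` along `Θ`
(`contMDiffAt_pullbackBilin_family`; target the vector space `E3`), injective because every `dΘ_u` is onto
(`mfderiv_bijective_of_injective`), admissible and shielded by diffeomorphism invariance/covariance
(`comap_mem_admissibleVacuumData`, `isKerrShielded_comap`).  O'Neill 1983, Ch. 3, Def. 3.9. [folklore] -/
theorem burial_comap (Θ : Diffeomorph (𝓡 3) (𝓡 3) Y E3 ∞) (hΘ : ContMDiff (𝓡 3) (𝓡 3) (∞ + 1) Θ)
    (hΘ' : ∀ u, Injective (mfderiv (𝓡 3) (𝓡 3) Θ u)) {d : InitialDataSet (𝓡 3) E3}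
    (h : ∃ F : EuclideanSpace ℝ (Fin 1) → InitialDataSet (𝓡 3) E3,
      InitialDataSet.IsSmoothDataFamily 1 F ∧ F 0 = d ∧ Injective F ∧
        (∀ c, F c ∈ admissibleVacuumData E3) ∧ ∀ c ≠ 0, IsKerrShielded E3 (F c)) :
    ∃ F : EuclideanSpace ℝ (Fin 1) → InitialDataSet (𝓡 3) Y,
      InitialDataSet.IsSmoothDataFamily 1 F ∧ F 0 = d.comap Θ hΘ hΘ' ∧ Injective F ∧
        (∀ c, F c ∈ admissibleVacuumData Y) ∧ ∀ c ≠ 0, IsKerrShielded Y (F c) := by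
  obtain ⟨F, hFs, hF0, hFinj, hFadm, hFsh⟩ := h
  refine ⟨fun c ↦ (F c).comap Θ hΘ hΘ', ?_, ?_, ?_, fun c ↦ comap_mem_admissibleVacuumData Θ hΘ hΘ' (hFadm c),
    fun c hc ↦ isKerrShielded_comap Θ hΘ hΘ' (hFsh c hc)⟩
  · -- joint smoothness: parametric pullback of the coordinate readings along `Θ`
    refine ⟨fun q ↦ ?_, fun q ↦ ?_⟩
    · have hc : ContMDiffAt (𝓘(ℝ, EuclideanSpace ℝ (Fin 1)).prod 𝓘(ℝ, E3)) 𝓘(ℝ, E3 →L[ℝ] E3 →L[ℝ] ℝ) ∞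
          (uncurry fun (p : EuclideanSpace ℝ (Fin 1)) (z : E3) ↦ (F p).coordH z) (q.1, Θ q.2) :=
        (contMDiffAt_bilinE3_iff.1 (hFs.1 (q.1, Θ q.2))).2
      exact Literature.Geometry.Manifold.contMDiffAt_pullbackBilin_family
        (IP := 𝓘(ℝ, EuclideanSpace ℝ (Fin 1))) (I' := 𝓡 3) (n := ∞) (f := Θ) (y₀ := q.2) (p₀ := q.1)
        ((hΘ q.2).of_le le_rfl) hc
    · have hc : ContMDiffAt (𝓘(ℝ, EuclideanSpace ℝ (Fin 1)).prod 𝓘(ℝ, E3)) 𝓘(ℝ, E3 →L[ℝ] E3 →L[ℝ] ℝ) ∞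
          (uncurry fun (p : EuclideanSpace ℝ (Fin 1)) (z : E3) ↦ (F p).coordK z) (q.1, Θ q.2) :=
        (contMDiffAt_bilinE3_iff.1 (hFs.2 (q.1, Θ q.2))).2
      exact Literature.Geometry.Manifold.contMDiffAt_pullbackBilin_family
        (IP := 𝓘(ℝ, EuclideanSpace ℝ (Fin 1))) (I' := 𝓡 3) (n := ∞) (f := Θ) (y₀ := q.2) (p₀ := q.1)
        ((hΘ q.2).of_le le_rfl) hc
  · show (F 0).comap Θ hΘ hΘ' = d.comap Θ hΘ hΘ'
    rw [hF0]
  · -- injective: every `dΘ_u` is onto, `Θ` is onto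
    intro c c' hcc'
    apply hFinj
    refine InitialDataSet.ext' (fun y v w ↦ ?_) (fun y v w ↦ ?_)
    · obtain ⟨v₁, hv₁⟩ := (mfderiv_bijective_of_injective (hΘ' (Θ.symm y)) rfl).2 v
      obtain ⟨w₁, hw₁⟩ := (mfderiv_bijective_of_injective (hΘ' (Θ.symm y)) rfl).2 w
      have h2 := congrArg (fun D : InitialDataSet (𝓡 3) Y ↦ D.h.inner (Θ.symm y) v₁ w₁) hcc'
      simp only [InitialDataSet.comap_h_inner, hv₁, hw₁] at h2
      rw [← InitialDataSet.coordH_apply, ← InitialDataSet.coordH_apply, Θ.apply_symm_apply] at h2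
      exact h2
    · obtain ⟨v₁, hv₁⟩ := (mfderiv_bijective_of_injective (hΘ' (Θ.symm y)) rfl).2 v
      obtain ⟨w₁, hw₁⟩ := (mfderiv_bijective_of_injective (hΘ' (Θ.symm y)) rfl).2 w
      have h2 := congrArg (fun D : InitialDataSet (𝓡 3) Y ↦ D.k (Θ.symm y) v₁ w₁) hcc'
      simp only [InitialDataSet.comap_k, hv₁, hw₁] at h2
      rw [← InitialDataSet.coordK_apply, ← InitialDataSet.coordK_apply, Θ.apply_symm_apply] at h2
      exact h2

end Transport

/-! ## §3 The crux at `(Minkowski.slice, trivialData)`; constant-coefficient flat data -/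

section Slice

variable [Kerr.Facts]

/-- **The crux at the tree's flat datum.** `KerrShieldedDataExist` implies the conclusion of
`ParametricKerrBurial` at `(X, d) = (Minkowski.slice, trivialData)` — the Minkowski slice `{t = 0} ≅ ℝ³` of
`ModelData.lean` with its trivial data `(δ, 0)` (`trivialData_mem_admissibleVacuumData`) — using the
dilation covariance of the shield now LANDED by the crux line (`CollarDilation.isKerrShieldedAway_dilate`), hence
UNCONDITIONALLY.  Proof: along the inclusion `ι : Minkowski.slice → E3` (an open
submanifold which is all of `E3`; `dι = id`, `OpenSubmanifold.mfderiv_subtype_val`) the flat datum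
`(ι⁻¹)^* trivialData` on `ℝ³` is admissible and Euclidean, so `flatBurial` buries it; transport the burial back
along `ι` (`burial_comap`) and note `ι^* (ι⁻¹)^* trivialData = trivialData`.  This is the instance on which the
disprover's `parametricKerrBurial_false_without_ne_zero` lives: WITH the guard `c ≠ 0` the burial of
`trivialData` exists as soon as one shielded background does. [folklore] -/
theorem trivialData_burial (hK : KerrShieldedDataExist) :
    ∃ F : EuclideanSpace ℝ (Fin 1) → InitialDataSet (𝓡 3) Minkowski.slice,
      InitialDataSet.IsSmoothDataFamily 1 F ∧ F 0 = trivialData ∧ Injective F ∧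
        (∀ c, F c ∈ admissibleVacuumData Minkowski.slice) ∧
          ∀ c ≠ 0, IsKerrShielded Minkowski.slice (F c) := by
  -- the inclusion `ι` and its inverse `κ`, as a diffeomorphism `Θ`
  set ι : Minkowski.slice → E3 := Subtype.val with hι
  set κ : E3 → Minkowski.slice := fun y ↦ ⟨y, Minkowski.mem_slice y⟩ with hκ
  have hιs : ContMDiff (𝓡 3) (𝓡 3) (∞ + 1) ι := InitialDataSet.contMDiff_subtypeVal_succ _
  have hι' : ∀ u, Injective (mfderiv (𝓡 3) (𝓡 3) ι u) := InitialDataSet.injective_mfderiv_subtypeVal _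
  have hdι : ∀ u : Minkowski.slice, mfderiv (𝓡 3) (𝓡 3) ι u = ContinuousLinearMap.id ℝ E3 := fun u ↦
    Literature.Geometry.Manifold.OpenSubmanifold.mfderiv_subtype_val u
  have hκs' : ContMDiff (𝓡 3) (𝓡 3) ∞ κ := (ContMDiff.subtypeVal_comp_iff _ κ).1 contMDiff_id
  have hκs : ContMDiff (𝓡 3) (𝓡 3) (∞ + 1) κ := hκs'.of_le (le_of_eq (by rfl))
  have hdκ : ∀ y : E3, mfderiv (𝓡 3) (𝓡 3) κ y = ContinuousLinearMap.id ℝ E3 := by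
    intro y
    have h1 : mfderiv (𝓡 3) (𝓡 3) (ι ∘ κ) y =
        (mfderiv (𝓡 3) (𝓡 3) ι (κ y)).comp (mfderiv (𝓡 3) (𝓡 3) κ y) :=
      mfderiv_comp y ((hιs.mdifferentiable (by simp)) (κ y)) ((hκs.mdifferentiable (by simp)) y)
    have h2 : ι ∘ κ = id := funext fun y ↦ rfl
    rw [h2, mfderiv_id, hdι] at h1
    rw [← ContinuousLinearMap.id_comp (mfderiv (𝓡 3) (𝓡 3) κ y)]
    exact h1.symm
  have hκ' : ∀ y, Injective (mfderiv (𝓡 3) (𝓡 3) κ y) := fun y ↦ by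
    rw [hdκ]; exact fun v w h ↦ h
  let Θ : Diffeomorph (𝓡 3) (𝓡 3) Minkowski.slice E3 ∞ :=
    { toFun := ι
      invFun := κ
      left_inv := fun u ↦ rfl
      right_inv := fun y ↦ rfl
      contMDiff_toFun := contMDiff_subtype_val
      contMDiff_invFun := hκs' }
  -- the flat datum `κ^* trivialData` on `ℝ³`: admissible, Euclidean; bury it
  set d : InitialDataSet (𝓡 3) E3 := trivialData.comap κ hκs hκ' with hd
  have hdadm : d ∈ admissibleVacuumData E3 :=
    comap_mem_admissibleVacuumData Θ.symm hκs hκ' trivialData_mem_admissibleVacuumData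
  have hdh : ∀ y v w : E3, d.h.inner y v w = ⟪v, w⟫_ℝ := fun y v w ↦ by
    rw [hd, InitialDataSet.comap_h_inner, hdκ, trivialData_h_inner]
    rfl
  have hdk : ∀ y v w : E3, d.k y v w = 0 := fun y v w ↦ by
    rw [hd, InitialDataSet.comap_k, trivialData_k]
    rfl
  obtain ⟨B, hB, hBs⟩ := hK
  -- transport the burial back along `ι`, and identify `ι^* κ^* trivialData = trivialData`
  have hback : d.comap ι hιs hι' = trivialData := by
    refine InitialDataSet.ext' (fun u v w ↦ ?_) (fun u v w ↦ ?_)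
    · rw [InitialDataSet.comap_h_inner, hdι, hd, InitialDataSet.comap_h_inner, hdκ]
      rfl
    · rw [InitialDataSet.comap_k, hd, InitialDataSet.comap_k]
      rfl
  rw [← hback]
  exact burial_comap Θ hιs hι' (flatBurial hB hBs hdadm hdh hdk)

end Slice

section ConstFlat

variable [Kerr.Facts]

/-- **Every admissible constant-coefficient flat datum on `ℝ³` is buried** (given one shielded background): if `d = (Q, 0)` with `Q` a CONSTANT (hence symmetric positive definite) form — the flat data in arbitrary
affine coordinates — then through `d` passes a burial family.  Reduce to the Euclidean case: in a `Q`-orthonormal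
frame `A` (`exists_frame`) the datum `A^* d` is Euclidean and admissible, `flatBurial` buries it, and the burial
transports back along `A⁻¹` (`burial_comap`) to `(A⁻¹)^* A^* d = d`. [folklore] -/
theorem constFlat_burial (hK : KerrShieldedDataExist) {d : InitialDataSet (𝓡 3) E3} (hd : d ∈ admissibleVacuumData E3)
    (hdh : ∀ y v w : E3, d.h.inner y v w = d.h.inner 0 v w) (hdk : ∀ y v w : E3, d.k y v w = 0) :
    ∃ F : EuclideanSpace ℝ (Fin 1) → InitialDataSet (𝓡 3) E3,
      InitialDataSet.IsSmoothDataFamily 1 F ∧ F 0 = d ∧ Injective F ∧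
        (∀ c, F c ∈ admissibleVacuumData E3) ∧ ∀ c ≠ 0, IsKerrShielded E3 (F c) := by
  obtain ⟨B, hB, hBs⟩ := hK
  -- a `Q`-orthonormal frame, `Q = h_d(0)`
  obtain ⟨A, hA⟩ := exists_frame (d.h.inner 0) (fun v w ↦ d.h.symm 0 v w) (fun v hv ↦ d.h.pos 0 v hv)
  set d' := d.comap A (contMDiff_linear A) (injective_mfderiv_linear A) with hd'
  have hd'adm : d' ∈ admissibleVacuumData E3 :=
    comap_mem_admissibleVacuumData A.toDiffeomorph (contMDiff_linear A) (injective_mfderiv_linear A) hd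
  have hd'h : ∀ y v w : E3, d'.h.inner y v w = ⟪v, w⟫_ℝ := fun y v w ↦ by
    rw [← InitialDataSet.coordH_apply, hd', coordH_comap_linear, InitialDataSet.coordH_apply, hdh]
    exact hA v w
  have hd'k : ∀ y v w : E3, d'.k y v w = 0 := fun y v w ↦ by
    rw [← InitialDataSet.coordK_apply, hd', coordK_comap_linear, InitialDataSet.coordK_apply, hdk]
  -- bury `A^* d`, transport back along `A⁻¹`, identify `(A⁻¹)^* A^* d = d`
  have hback : d'.comap A.symm (contMDiff_linear A.symm) (injective_mfderiv_linear A.symm) = d := by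
    refine InitialDataSet.ext' (fun y v w ↦ ?_) (fun y v w ↦ ?_)
    · rw [← InitialDataSet.coordH_apply, coordH_comap_linear, hd', coordH_comap_linear]
      simp only [ContinuousLinearEquiv.apply_symm_apply]
      rfl
    · rw [← InitialDataSet.coordK_apply, coordK_comap_linear, hd', coordK_comap_linear]
      simp only [ContinuousLinearEquiv.apply_symm_apply]
      rfl
  rw [← hback]
  exact burial_comap A.symm.toDiffeomorph (contMDiff_linear A.symm) (injective_mfderiv_linear A.symm)
    (flatBurial hB hBs hd'adm hd'h hd'k)

end ConstFlat

section FlatStratum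

variable [Kerr.Facts] {X : Type} [TopologicalSpace X] [ChartedSpace E3 X] [IsManifold (𝓡 3) ∞ X]

/-- **The item on the whole flat stratum.**  `KerrShieldedDataExist` implies the conclusion of
`ParametricKerrBurial` at every `(X, d)` with `X ≅ ℝ³` by a diffeomorphism `Θ` and `d = Θ^*(Q, 0)` the pullback of an
admissible constant-coefficient flat datum — i.e. at every admissible datum which is, in one global chart, flat with
constant coefficients (`constFlat_burial` transported by `burial_comap`). [folklore] -/
theorem burial_comap_constFlat (hK : KerrShieldedDataExist) (Θ : Diffeomorph (𝓡 3) (𝓡 3) X E3 ∞)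
    (hΘ : ContMDiff (𝓡 3) (𝓡 3) (∞ + 1) Θ) (hΘ' : ∀ u, Injective (mfderiv (𝓡 3) (𝓡 3) Θ u))
    {d₀ : InitialDataSet (𝓡 3) E3} (hd₀ : d₀ ∈ admissibleVacuumData E3)
    (hdh : ∀ y v w : E3, d₀.h.inner y v w = d₀.h.inner 0 v w) (hdk : ∀ y v w : E3, d₀.k y v w = 0) :
    ∃ F : EuclideanSpace ℝ (Fin 1) → InitialDataSet (𝓡 3) X,
      InitialDataSet.IsSmoothDataFamily 1 F ∧ F 0 = d₀.comap Θ hΘ hΘ' ∧ Injective F ∧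
        (∀ c, F c ∈ admissibleVacuumData X) ∧ ∀ c ≠ 0, IsKerrShielded X (F c) :=
  burial_comap Θ hΘ hΘ' (constFlat_burial hK hd₀ hdh hdk)

end FlatStratum

end Summit.FinalStateConjecture.FinalStateConjecture.Theorems.SwallowTheDatum.BurialIntoShieldedBackground

end
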